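import Mathlib.Algebra.CharZero.Infinite
import Literature.Computability.AlgebraicComplexity.MultiplicityObstructions
import Literature.Computability.Complexity.OccurrenceObstructionsBIP
import HarnessLib

/-!
# The types of representation-theoretic obstructions in geometric complexity theory:
# occurrence, vanishing-ideal occurrence, and pure multiplicity obstructions

Topic `Literature/Computability/AlgebraicComplexity`. A typed census of WHAT KIND of obstruction
can still separate orbit closures once occurrence obstructions are excluded, over the tree's
numeric multiplicities `orbitMultiplicity k f m χ = mult_χ k[Δ_m[f]]` and
`plethysmCoeff k σ m χ = mult_χ k[Sym^m (k^σ)]` (`SchurWeylPlethysm.lean`) and the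
multiplicity-obstruction principle `orbitMultiplicity_le_of_mem_orbitClosure`
(`MultiplicityObstructions.lean`, discharged in `MultiplicityObstructionsProofs.lean`).

WHAT IS REPRODUCED (verbatim sources; `f` is the "model" form whose orbit closure `Δ_m[f]` should
NOT contain the "hard" form `g`):

* **Multiplicity obstruction** (`IsMultiplicityObstructionAt`). Bläser–Ikenmeyer, ToC Graduate
  Surveys 10 (2025), §12.4 (p. 74): "if we want to prove `Z₀ ⊄ Z`, it is sufficient to show the
  existence of some `λ` that satisfies `mult_λ(ℂ[Z]) < mult_λ(ℂ[Z₀])`. Such `λ` are called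
  representation theoretic multiplicity obstructions." Dörfler–Ikenmeyer–Panova, SIAGA 4 (2020),
  §2 (arXiv:1901.04576, p. 4): "a partition `λ` that violates (2.2)
  [`mult_λ(ℂ[Ch_m^n]_d) ≥ mult_λ(ℂ[Pow_{m,k}^n]_d)`] proves that `Pow_{m,k}^n ⊄ Ch_m^n`. Such a `λ`
  is called a multiplicity obstruction."
* **Occurrence obstruction** (`IsOccurrenceObstructionAt`). Same place: "If additionally
  `mult_λ(ℂ[Ch_m^n]_d) = 0`, then `λ` is called an occurrence obstruction."
  Bürgisser–Ikenmeyer–Panova, J. AMS 32 (2019), abstract: occurrence obstructions are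
  "irreducible representations of `GL_{n²}(ℂ)`, which occur in one coordinate ring of the orbit
  closure, but not in the other", and §1.1: "if `λ` occurs in `ℂ[Z_{n,m}]`, then it must also
  occur in `ℂ[Ω_n]`. A partition `λ` violating this condition is called an occurrence
  obstruction"; Ikenmeyer–Kandasamy, arXiv:1911.03990 §2 (p. 3): "types `λ` for which the
  stronger property `mult_λ ℂ[\overline{G per_{m,n}}] > 0 = mult_λ ℂ[\overline{G det_n}]` holds".
* **Vanishing ideal occurrence obstruction** (`IsVanishingIdealOccurrenceObstructionAt`).
  Ikenmeyer–Kandasamy, arXiv:1911.03990 §2 (p. 3): "The types `λ` that are used in [DIP:19] occur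
  in the vanishing ideal of one orbit closure, but not in the vanishing ideal of the other, hence
  we call them vanishing ideal occurrence obstructions." In characteristic zero
  `k[Sym^m]_d = I(Δ[f])_d ⊕ k[Δ[f]]_d` as representations, so "`λ` occurs in `I(Δ[f])`" is
  `mult_λ k[Δ[f]] < mult_λ k[Sym^m]` and "`λ` does not occur in `I(Δ[g])`" is
  `mult_λ k[Δ[g]] = mult_λ k[Sym^m]`; this is the numeric rendering used here.
* **Pure multiplicity obstruction** (`IsPureMultiplicityObstructionAt`): a multiplicity
  obstruction that is neither of the two previous kinds, i.e. `0 < mult_λ k[Δ[f]] < mult_λ k[Δ[g]]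
  < mult_λ k[Sym^m]`. Ikenmeyer–Kandasamy §2 (p. 3): "Theorem 4.3 gives the first family of
  multiplicity obstructions that are neither occurrence obstructions nor vanishing ideal
  occurrence obstructions, see Proposition 5.3."

WHAT IS PROVED HERE (kernel, no facts): each special kind is a multiplicity obstruction; the
pure kind excludes the other two; the TRICHOTOMY `isMultiplicityObstructionAt_trichotomy`
(every multiplicity obstruction is of one of the three kinds, given the BLMW bound
`mult_χ k[Δ[g]] ≤ mult_χ k[Sym^m]`, i.e. the named fact `orbitMultiplicity_le_plethysmCoeff`,
discharged in `MultiplicityObstructionsProofs.lean`); separation from a multiplicity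
obstruction (`not_mem_orbitClosure_of_isMultiplicityObstructionAt`, from the principle); and the
consequence of BIP's Theorem 1.4 in this vocabulary: for `0 < n`, `n ^ 25 ≤ m` there is no
occurrence obstruction against BIP's padded permanent lying in `Δ(det_m)`
(`not_isOccurrenceObstructionAt_det_of_bip2019`, from the tree's statement
`Complexity.bip2019_no_occurrence_obstructions`, discharged as
`Complexity.bip2019_no_occurrence_obstructions_holds`), so that every multiplicity obstruction in
that regime — if one exists, which is OPEN — is a vanishing-ideal occurrence obstruction or a pure
multiplicity obstruction (`bip2019_remaining_obstruction_types`). Which of these two kinds exists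
for determinant versus permanent is not known; in toy models both kinds are exhibited in print
(Dörfler–Ikenmeyer–Panova 2020 Thm. 2.3: vanishing-ideal occurrence obstructions for power sums
versus the Chow variety; Ikenmeyer–Kandasamy Thm. 4.3 with Prop. 5.3: pure multiplicity
obstructions for the power sum versus the product `x₁ ⋯ x_m`).

Design. All predicates are numeric statements about `hwMultiplicity` at ONE highest weight `χ`
(a weight pins the degree, `finiteDimensional_highestWeightSpace_orbitCoordRep`), matching the
printed "`mult_λ`" language; the map-theoretic degree-`d` predicates `HasMultiplicityObstruction` /
`HasOccurrenceObstruction` of `GCTObstructions.lean` are the existential ("some `λ` in degree `d`")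
versions and are related to these through complete reducibility
(`hwMultiplicity_eq_finrank_intertwiningMap`); that bridge is deliberately NOT restated here.
Partitions enter through the tree's dual-weight convention (`Weight.dualOfPartition`,
`Complexity.partitionWeightLex`): "`λ` occurs in `ℂ[Z]`" is `HasHighestWeight ρ_Z λ^*`.
NOT here: any existence statement for determinant versus permanent (open), the toy-model theorems
(separate per-paper files), saturation / positivity questions.

## References

* M. Bläser, C. Ikenmeyer, *Introduction to Geometric Complexity Theory*, Theory of Computing
  Graduate Surveys 10 (2025), §12.4. [BlaeserIkenmeyer2025]
* P. Bürgisser, C. Ikenmeyer, G. Panova, *No occurrence obstructions in geometric complexity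
  theory*, J. Amer. Math. Soc. 32 (2019) 163–193, §1.1, §1.3, Thm. 1.4. [BurgisserIkenmeyerPanovaJAMS2019]
* J. Dörfler, C. Ikenmeyer, G. Panova, *On geometric complexity theory: Multiplicity obstructions
  are stronger than occurrence obstructions*, SIAM J. Appl. Algebra Geom. 4 (2020) 354–376
  (arXiv:1901.04576), §2 eq. (2.2), Thm. 2.3. [DorflerIkenmeyerPanova2020]
* C. Ikenmeyer, U. Kandasamy, *Implementing geometric complexity theory: On the separation of
  orbit closures via symmetries*, STOC 2020 (arXiv:1911.03990), §2, Thm. 4.3, Prop. 5.3.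
  [IkenmeyerKandasamy2019]
* P. Bürgisser, J. M. Landsberg, L. Manivel, J. Weyman, *An overview of mathematical issues
  arising in the geometric complexity theory approach to VP ≠ VNP*, SIAM J. Comput. 40 (2011),
  §4.4, §5.2. [BLMW2011]

Provenance: pub-gct census cell (typed skeleton of the post-BIP obstruction landscape); locators
are arXiv-version theorem numbers and PDF pages where the journal pagination was not held.
-/

open MvPolynomial

namespace Literature.Computability.AlgebraicComplexity

open _root_.Literature.NumberTheory.DiophantineGeometry

variable {k : Type} [Field k] {σ : Type} [Fintype σ] [LinearOrder σ]

/-- `IsMultiplicityObstructionAt f g m χ`: the highest weight `χ` is a *multiplicity obstruction*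
against `g ∈ Δ_m[f]`, i.e. `mult_χ k[Δ_m[f]] < mult_χ k[Δ_m[g]]` (numeric form over
`orbitMultiplicity`). Bläser–Ikenmeyer 2025 §12.4 ("Such `λ` are called representation theoretic
multiplicity obstructions"); Dörfler–Ikenmeyer–Panova 2020 §2, eq. (2.2).
[cite: BlaeserIkenmeyer2025, §12.4] -/
def IsMultiplicityObstructionAt (f g : MvPolynomial σ k) (m : ℕ) (χ : Weight σ) : Prop :=
  orbitMultiplicity k f m χ < orbitMultiplicity k g m χ

/-- `IsOccurrenceObstructionAt f g m χ`: `χ` is an *occurrence obstruction* against `g ∈ Δ_m[f]`: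
`V(χ)` occurs in `k[Δ_m[g]]` but not in `k[Δ_m[f]]`, i.e. `mult_χ k[Δ_m[f]] = 0 < mult_χ k[Δ_m[g]]`.
Bürgisser–Ikenmeyer–Panova 2019 §1.1; Dörfler–Ikenmeyer–Panova 2020 §2 ("If additionally
`mult_λ(ℂ[Ch_m^n]_d) = 0`, then `λ` is called an occurrence obstruction").
[cite: BurgisserIkenmeyerPanovaJAMS2019, §1.1] -/
def IsOccurrenceObstructionAt (f g : MvPolynomial σ k) (m : ℕ) (χ : Weight σ) : Prop :=
  orbitMultiplicity k f m χ = 0 ∧ 0 < orbitMultiplicity k g m χ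

/-- `IsVanishingIdealOccurrenceObstructionAt f g m χ`: `χ` is a *vanishing ideal occurrence
obstruction* against `g ∈ Δ_m[f]`: `V(χ)` occurs in the vanishing ideal `I(Δ_m[f]) ⊆ k[Sym^m]`
(`mult_χ k[Δ_m[f]] < mult_χ k[Sym^m]`) but not in `I(Δ_m[g])` (`mult_χ k[Δ_m[g]] = mult_χ k[Sym^m]`,
the plethysm coefficient). Ikenmeyer–Kandasamy, arXiv:1911.03990, §2 (p. 3): "occur in the
vanishing ideal of one orbit closure, but not in the vanishing ideal of the other, hence we call
them vanishing ideal occurrence obstructions" (the obstructions of Dörfler–Ikenmeyer–Panova 2020,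
Thm. 2.3, are of this kind). [cite: IkenmeyerKandasamy2019, §2] -/
def IsVanishingIdealOccurrenceObstructionAt (f g : MvPolynomial σ k) (m : ℕ) (χ : Weight σ) :
    Prop :=
  orbitMultiplicity k f m χ < plethysmCoeff k σ m χ ∧
    orbitMultiplicity k g m χ = plethysmCoeff k σ m χ

/-- `IsPureMultiplicityObstructionAt f g m χ`: `χ` is a multiplicity obstruction against
`g ∈ Δ_m[f]` that is NEITHER an occurrence obstruction NOR a vanishing ideal occurrence
obstruction: `0 < mult_χ k[Δ_m[f]] < mult_χ k[Δ_m[g]] < mult_χ k[Sym^m]` (both irreducibles occur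
in both coordinate rings and in both vanishing ideals; only the multiplicities differ).
Ikenmeyer–Kandasamy, arXiv:1911.03990, §2 (p. 3) and Prop. 5.3 ("neither occurrence obstructions
nor vanishing ideal occurrence obstructions"). [cite: IkenmeyerKandasamy2019, §2 and Prop. 5.3] -/
def IsPureMultiplicityObstructionAt (f g : MvPolynomial σ k) (m : ℕ) (χ : Weight σ) : Prop :=
  0 < orbitMultiplicity k f m χ ∧ orbitMultiplicity k f m χ < orbitMultiplicity k g m χ ∧
    orbitMultiplicity k g m χ < plethysmCoeff k σ m χ

variable {f g : MvPolynomial σ k} {m : ℕ} {χ : Weight σ}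

/-- An occurrence obstruction is a multiplicity obstruction (`0 = mult_χ(f) < mult_χ(g)`).
Dörfler–Ikenmeyer–Panova 2020 §2 (occurrence obstructions are the multiplicity obstructions with
"additionally `mult_λ(ℂ[Ch_m^n]_d) = 0`"); BIP 2019 §1.3 ("there still remains the possibility
that one may succeed so by comparing multiplicities"). [cite: DorflerIkenmeyerPanova2020, §2] -/
theorem IsOccurrenceObstructionAt.isMultiplicityObstructionAt
    (h : IsOccurrenceObstructionAt f g m χ) : IsMultiplicityObstructionAt f g m χ := by
  unfold IsMultiplicityObstructionAt
  unfold IsOccurrenceObstructionAt at h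
  omega

/-- A vanishing ideal occurrence obstruction is a multiplicity obstruction
(`mult_χ(f) < mult_χ k[Sym^m] = mult_χ(g)`). Ikenmeyer–Kandasamy §2; Dörfler–Ikenmeyer–Panova
2020 §3 (proof of Thm. 2.3: `mult_λ ℂ[Pow]_d = a_λ(d[n]) > mult_λ ℂ[Ch]_d`).
[cite: IkenmeyerKandasamy2019, §2] -/
theorem IsVanishingIdealOccurrenceObstructionAt.isMultiplicityObstructionAt
    (h : IsVanishingIdealOccurrenceObstructionAt f g m χ) : IsMultiplicityObstructionAt f g m χ := by
  unfold IsMultiplicityObstructionAt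
  unfold IsVanishingIdealOccurrenceObstructionAt at h
  omega

/-- A pure multiplicity obstruction is a multiplicity obstruction. Ikenmeyer–Kandasamy §2.
[cite: IkenmeyerKandasamy2019, §2] -/
theorem IsPureMultiplicityObstructionAt.isMultiplicityObstructionAt
    (h : IsPureMultiplicityObstructionAt f g m χ) : IsMultiplicityObstructionAt f g m χ :=
  h.2.1

/-- A pure multiplicity obstruction is not an occurrence obstruction (`mult_χ(f) > 0`).
Ikenmeyer–Kandasamy Prop. 5.3 (second bullet). [cite: IkenmeyerKandasamy2019, Prop. 5.3] -/
theorem IsPureMultiplicityObstructionAt.not_isOccurrenceObstructionAt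
    (h : IsPureMultiplicityObstructionAt f g m χ) : ¬ IsOccurrenceObstructionAt f g m χ := by
  unfold IsPureMultiplicityObstructionAt at h
  unfold IsOccurrenceObstructionAt
  omega

/-- A pure multiplicity obstruction is not a vanishing ideal occurrence obstruction
(`mult_χ(g) < mult_χ k[Sym^m]`). Ikenmeyer–Kandasamy Prop. 5.3 (first bullet).
[cite: IkenmeyerKandasamy2019, Prop. 5.3] -/
theorem IsPureMultiplicityObstructionAt.not_isVanishingIdealOccurrenceObstructionAt
    (h : IsPureMultiplicityObstructionAt f g m χ) :
    ¬ IsVanishingIdealOccurrenceObstructionAt f g m χ := by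
  unfold IsPureMultiplicityObstructionAt at h
  unfold IsVanishingIdealOccurrenceObstructionAt
  omega

/-- **Trichotomy of multiplicity obstructions** (numeric form). If `mult_χ k[Δ_m[g]] ≤ mult_χ
k[Sym^m]` (BLMW's bound, `orbitMultiplicity_le_plethysmCoeff`), then a multiplicity obstruction
`χ` against `g ∈ Δ_m[f]` is an occurrence obstruction, or a vanishing ideal occurrence
obstruction, or a pure multiplicity obstruction (the first two may overlap, when
`mult_χ(f) = 0` and `mult_χ(g) = mult_χ k[Sym^m]`). This is the case split behind
Ikenmeyer–Kandasamy §2 / Prop. 5.3; elementary arithmetic. [folklore] -/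
theorem isMultiplicityObstructionAt_trichotomy
    (hle : orbitMultiplicity k g m χ ≤ plethysmCoeff k σ m χ)
    (h : IsMultiplicityObstructionAt f g m χ) :
    IsOccurrenceObstructionAt f g m χ ∨ IsVanishingIdealOccurrenceObstructionAt f g m χ ∨
      IsPureMultiplicityObstructionAt f g m χ := by
  unfold IsMultiplicityObstructionAt at h
  unfold IsOccurrenceObstructionAt IsVanishingIdealOccurrenceObstructionAt
    IsPureMultiplicityObstructionAt
  omega

/-- The trichotomy with BLMW's bound supplied by the named fact
`orbitMultiplicity_le_plethysmCoeff` (characteristic zero, `g` a form of degree `m ≠ 0`;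
discharged as `orbitMultiplicity_le_plethysmCoeff_holds`). BLMW 2011 §4.4, §5.2;
Ikenmeyer–Kandasamy §2. [cite: BLMW2011, §4.4 and §5.2] -/
theorem isMultiplicityObstructionAt_trichotomy_of_isHomogeneous [CharZero k]
    (hpl : orbitMultiplicity_le_plethysmCoeff (k := k) (σ := σ)) (hm : m ≠ 0)
    (hg : g.IsHomogeneous m) (h : IsMultiplicityObstructionAt f g m χ) :
    IsOccurrenceObstructionAt f g m χ ∨ IsVanishingIdealOccurrenceObstructionAt f g m χ ∨
      IsPureMultiplicityObstructionAt f g m χ :=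
  isMultiplicityObstructionAt_trichotomy (hpl g hm hg χ) h

/-- **Separation from a multiplicity obstruction.** In characteristic zero, for forms `f, g` of
degree `m ≠ 0`, a multiplicity obstruction `χ` against `g ∈ Δ_m[f]` proves `g ∉ Δ_m[f]`
(contrapositive of the principle `orbitMultiplicity_le_of_mem_orbitClosure`, discharged as
`orbitMultiplicity_le_of_mem_orbitClosure_holds`). Bläser–Ikenmeyer 2025 §12.4;
Dörfler–Ikenmeyer–Panova 2020 §2. [cite: BlaeserIkenmeyer2025, §12.4] -/
theorem not_mem_orbitClosure_of_isMultiplicityObstructionAt [CharZero k]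
    (hprin : orbitMultiplicity_le_of_mem_orbitClosure) (hm : m ≠ 0) (hf : f.IsHomogeneous m)
    (hg : g.IsHomogeneous m) (h : IsMultiplicityObstructionAt f g m χ) :
    g ∉ orbitClosure f := fun hmem =>
  (not_le.mpr h) (hprin f g hm hf hg hmem χ)

/-- **BIP's Theorem 1.4 in this vocabulary.** For `0 < n` and `n ^ 25 ≤ m`, no highest weight
`χ` of `GL_{m²}` is an occurrence obstruction against BIP's padded permanent
`X₀₀^{m-n} per_n` (`Complexity.bipPaddedPerFormLex ℂ n m`, padding variable inside the block)
lying in `Δ(det_m)` (`detFormLex ℂ m`): if `mult_χ ℂ[Δ(X₀₀^{m-n} per_n)] > 0` then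
`mult_χ ℂ[Δ(det_m)] > 0`. From the tree's statement `Complexity.bip2019_no_occurrence_obstructions`
(discharged: `Complexity.bip2019_no_occurrence_obstructions_holds`) and finite-dimensionality of
highest-weight spaces (`finiteDimensional_highestWeightSpace_orbitCoordRep`, discharged as
`finiteDimensional_highestWeightSpace_orbitCoordRep_holds`). Bürgisser–Ikenmeyer–Panova, J. AMS 32
(2019), Thm. 1.4 ("`n ≥ m^{25}`" in their letters `per_m`, `det_n`).
[cite: BurgisserIkenmeyerPanovaJAMS2019, Thm. 1.4] -/
theorem not_isOccurrenceObstructionAt_det_of_bip2019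
    (hbip : Complexity.bip2019_no_occurrence_obstructions)
    (hfin : ∀ m : ℕ, finiteDimensional_highestWeightSpace_orbitCoordRep (k := ℂ) (σ := MatIdx m))
    {n m : ℕ} [NeZero m] (hn : 0 < n) (hnm : n ^ 25 ≤ m) (χ : Weight (MatIdx m)) :
    ¬ IsOccurrenceObstructionAt (detFormLex ℂ m) (Complexity.bipPaddedPerFormLex ℂ n m) m χ := by
  rintro ⟨hdet, hper⟩
  have hocc : HasHighestWeight (Complexity.bipPaddedPerOrbitRep ℂ n m) χ := by
    intro hbot
    have e : Complexity.bipPaddedPerOrbitRep ℂ n m =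
        orbitCoordRep (Complexity.bipPaddedPerFormLex ℂ n m) m := rfl
    rw [e] at hbot
    have h0 : orbitMultiplicity ℂ (Complexity.bipPaddedPerFormLex ℂ n m) m χ = 0 := by
      unfold orbitMultiplicity hwMultiplicity
      rw [hbot, finrank_bot]
    omega
  have hdet' : HasHighestWeight (orbitCoordRep (detFormLex ℂ m) m) χ := hbip n m hn hnm χ hocc
  haveI : FiniteDimensional ℂ (highestWeightSpace (orbitCoordRep (detFormLex ℂ m) m) χ) :=
    hfin m (detFormLex ℂ m) (NeZero.ne m) χ
  haveI : Nontrivial (highestWeightSpace (orbitCoordRep (detFormLex ℂ m) m) χ) :=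
    Submodule.nontrivial_iff_ne_bot.mpr hdet'
  have hpos : 0 < Module.finrank ℂ (highestWeightSpace (orbitCoordRep (detFormLex ℂ m) m) χ) :=
    Module.finrank_pos
  unfold orbitMultiplicity hwMultiplicity at hdet
  omega

/-- **What remains after BIP** (the census statement). For `0 < n`, `n ^ 25 ≤ m`, every
multiplicity obstruction `χ` against BIP's padded permanent lying in `Δ(det_m)` — should one
exist, which is OPEN (Mulmuley–Sohoni's Conjecture, BIP 2019 Conj. 1.2 in multiplicity form)
— is a vanishing ideal occurrence obstruction or a pure multiplicity obstruction, never an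
occurrence obstruction. Kernel consequence of `not_isOccurrenceObstructionAt_det_of_bip2019` and
the trichotomy; hypotheses are the named facts of those two theorems. BIP 2019, abstract ("we do
not rule out the general approach to the permanent versus determinant problem via multiplicity
obstructions") and §1.3 ("there still remains the possibility that one may succeed so by
comparing multiplicities"). [cite: BurgisserIkenmeyerPanovaJAMS2019, abstract and §1.3] -/
theorem bip2019_remaining_obstruction_types
    (hbip : Complexity.bip2019_no_occurrence_obstructions)
    (hfin : ∀ m : ℕ, finiteDimensional_highestWeightSpace_orbitCoordRep (k := ℂ) (σ := MatIdx m))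
    (hpl : ∀ m : ℕ, orbitMultiplicity_le_plethysmCoeff (k := ℂ) (σ := MatIdx m))
    {n m : ℕ} [NeZero m] (hn : 0 < n) (hnm : n ^ 25 ≤ m) (χ : Weight (MatIdx m))
    (h : IsMultiplicityObstructionAt (detFormLex ℂ m) (Complexity.bipPaddedPerFormLex ℂ n m) m χ) :
    IsVanishingIdealOccurrenceObstructionAt (detFormLex ℂ m) (Complexity.bipPaddedPerFormLex ℂ n m) m χ ∨
      IsPureMultiplicityObstructionAt (detFormLex ℂ m) (Complexity.bipPaddedPerFormLex ℂ n m) m χ := by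
  have hnm' : n ≤ m := (Nat.le_self_pow (by norm_num) n).trans hnm
  rcases isMultiplicityObstructionAt_trichotomy_of_isHomogeneous (hpl m) (NeZero.ne m)
      (Complexity.bipPaddedPerFormLex_isHomogeneous (k := ℂ) hnm') h with hocc | hrest
  · exact absurd hocc (not_isOccurrenceObstructionAt_det_of_bip2019 hbip hfin hn hnm χ)
  · exact hrest


/-! ## BIP §2(d): no occurrence obstructions for (border) Waring rank either — Cor. 2.6 as a
named fact, and what it leaves in the power-sum model -/

section PowerSumModel

variable (k) in
/-- **BIP's `PS_n`, the power-sum orbit closure (the border-Waring-rank model).** BIP §2(d)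
(arXiv p. 7): "One may think of proving lower bounds on the Waring rank by studying the orbit
closure `PS_n := \overline{GL_{n²} · (X_1^n + ⋯ + X_{n²}^n)} ⊆ Sym^n (ℂ^{n²})^*` of the power sum
with `n²` terms." In this file's letters (size `m`, as for `detFormLex`): the power sum
`∑_i X_i ^ m` of ALL `m²` lexicographically ordered matrix variables `MatIdx m`, a form of degree
`m` (`psFormLex_isHomogeneous`); `PS_m` is its `orbitClosure`, `ℂ[PS_m]` its `orbitCoordRep … m`.
[cite: BurgisserIkenmeyerPanovaJAMS2019, §2(d)] -/
noncomputable def psFormLex (m : ℕ) : MvPolynomial (MatIdx m) k :=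
  ∑ i : MatIdx m, X i ^ m

/-- The power sum of the `m²` matrix variables is homogeneous of degree `m`. [folklore] -/
theorem psFormLex_isHomogeneous (m : ℕ) : (psFormLex k m).IsHomogeneous m := by
  unfold psFormLex
  refine IsHomogeneous.sum _ _ _ fun i _ => ?_
  simpa using (isHomogeneous_X k i).pow m

/-- **BIP Cor. 2.6, verbatim** (Bürgisser–Ikenmeyer–Panova, J. AMS 32 (2019) =
arXiv:1604.06431v3, §2(d) "No occurrence obstructions for Waring rank", arXiv p. 7): "Let
`n, d, m` be positive integers with `n ≥ m^{25}` and `λ ⊢ nd`. If `λ` occurs in `ℂ[Z_{n,m}]`, then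
`λ` also occurs in `ℂ[PS_n]`." Continued (same page): "Recall that in this statement, `Z_{n,m}`
is the orbit closure of the padded permanent `X^{n-m} per_m`; see (1.2). Tracing the proof
reveals that the permanent can be replaced by any homogeneous polynomial `p` of degree `m` in
`m²` variables. So we obtain the dramatic result that the strategy of occurrence obstructions
cannot even be used in the weaker model of `PS_n` against padded polynomials." Rendered EXACTLY
like the tree's `Complexity.bip2019_no_occurrence_obstructions` (BIP Thm. 1.4): letters swapped
(permanent `n`, power-sum / determinant size `m`, threshold `n ^ 25 ≤ m`, `0 < n`), weight /
highest-weight-vector form, BIP's own padded permanent `Complexity.bipPaddedPerOrbitRep`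
(padding variable a variable OF `per_n`), with `ℂ[Ω_m]` replaced by
`ℂ[PS_m] = orbitCoordRep (psFormLex ℂ m) m`. A published, proved corollary carried as a NAMED
FACT — not discharged here (BIP obtain it by re-running the proof of Thm. 1.4 with `PS_n` in
place of `Ω_n`: "The only information used about the orbit closure of the determinant `Ω_n` in
the proof of our main result is that it contains certain padded power sums (Theorem 2.5)" and
those padded power sums `X_1^{n-s} p` have Waring rank `≤ n k ≤ n²`, "so `X_1^{n-s} p ∈ PS_n`",
arXiv p. 7). [cite: BurgisserIkenmeyerPanovaJAMS2019, Cor. 2.6] -/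
def bip2019_cor_2_6 : Prop :=
  ∀ (n m : ℕ) [NeZero m] (_hn : 0 < n) (_hnm : n ^ 25 ≤ m) (χ : Weight (MatIdx m))
    (_h : HasHighestWeight (Complexity.bipPaddedPerOrbitRep ℂ n m) χ),
    HasHighestWeight (orbitCoordRep (psFormLex ℂ m) m) χ

/-- **BIP Cor. 2.6 in this vocabulary**: for `0 < n`, `n ^ 25 ≤ m`, no highest weight `χ` of
`GL_{m²}` is an occurrence obstruction against BIP's padded permanent lying in the power-sum
orbit closure `PS_m`: `mult_χ ℂ[Δ(X₀₀^{m-n} per_n)] > 0 → mult_χ ℂ[PS_m] > 0`. From the named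
fact `bip2019_cor_2_6` and finite-dimensionality of highest-weight spaces, exactly as
`not_isOccurrenceObstructionAt_det_of_bip2019`. [cite: BurgisserIkenmeyerPanovaJAMS2019, Cor. 2.6] -/
theorem not_isOccurrenceObstructionAt_ps_of_bip2019_cor_2_6
    (h26 : bip2019_cor_2_6)
    (hfin : ∀ m : ℕ, finiteDimensional_highestWeightSpace_orbitCoordRep (k := ℂ) (σ := MatIdx m))
    {n m : ℕ} [NeZero m] (hn : 0 < n) (hnm : n ^ 25 ≤ m) (χ : Weight (MatIdx m)) :
    ¬ IsOccurrenceObstructionAt (psFormLex ℂ m) (Complexity.bipPaddedPerFormLex ℂ n m) m χ := by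
  rintro ⟨hps, hper⟩
  have hocc : HasHighestWeight (Complexity.bipPaddedPerOrbitRep ℂ n m) χ := by
    intro hbot
    have e : Complexity.bipPaddedPerOrbitRep ℂ n m =
        orbitCoordRep (Complexity.bipPaddedPerFormLex ℂ n m) m := rfl
    rw [e] at hbot
    have h0 : orbitMultiplicity ℂ (Complexity.bipPaddedPerFormLex ℂ n m) m χ = 0 := by
      unfold orbitMultiplicity hwMultiplicity
      rw [hbot, finrank_bot]
    omega
  have hps' : HasHighestWeight (orbitCoordRep (psFormLex ℂ m) m) χ := h26 n m hn hnm χ hocc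
  haveI : FiniteDimensional ℂ (highestWeightSpace (orbitCoordRep (psFormLex ℂ m) m) χ) :=
    hfin m (psFormLex ℂ m) (NeZero.ne m) χ
  haveI : Nontrivial (highestWeightSpace (orbitCoordRep (psFormLex ℂ m) m) χ) :=
    Submodule.nontrivial_iff_ne_bot.mpr hps'
  have hpos : 0 < Module.finrank ℂ (highestWeightSpace (orbitCoordRep (psFormLex ℂ m) m) χ) :=
    Module.finrank_pos
  unfold orbitMultiplicity hwMultiplicity at hps
  omega

/-- **What Cor. 2.6 leaves in the power-sum model** (census row R6: "occurrence DEAD,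
multiplicity OPEN"). For `0 < n`, `n ^ 25 ≤ m`, every multiplicity obstruction `χ` against BIP's
padded permanent lying in `PS_m` — should one exist, which is open in print — is a vanishing
ideal occurrence obstruction or a pure multiplicity obstruction, never an occurrence
obstruction. Kernel consequence of `not_isOccurrenceObstructionAt_ps_of_bip2019_cor_2_6` and the
trichotomy. BIP §2(d), arXiv p. 7 ("cannot even be used in the weaker model of `PS_n`").
[cite: BurgisserIkenmeyerPanovaJAMS2019, Cor. 2.6] -/
theorem bip2019_remaining_obstruction_types_ps
    (h26 : bip2019_cor_2_6)
    (hfin : ∀ m : ℕ, finiteDimensional_highestWeightSpace_orbitCoordRep (k := ℂ) (σ := MatIdx m))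
    (hpl : ∀ m : ℕ, orbitMultiplicity_le_plethysmCoeff (k := ℂ) (σ := MatIdx m))
    {n m : ℕ} [NeZero m] (hn : 0 < n) (hnm : n ^ 25 ≤ m) (χ : Weight (MatIdx m))
    (h : IsMultiplicityObstructionAt (psFormLex ℂ m) (Complexity.bipPaddedPerFormLex ℂ n m) m χ) :
    IsVanishingIdealOccurrenceObstructionAt (psFormLex ℂ m) (Complexity.bipPaddedPerFormLex ℂ n m) m χ ∨
      IsPureMultiplicityObstructionAt (psFormLex ℂ m) (Complexity.bipPaddedPerFormLex ℂ n m) m χ := by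
  have hnm' : n ≤ m := (Nat.le_self_pow (by norm_num) n).trans hnm
  rcases isMultiplicityObstructionAt_trichotomy_of_isHomogeneous (hpl m) (NeZero.ne m)
      (Complexity.bipPaddedPerFormLex_isHomogeneous (k := ℂ) hnm') h with hocc | hrest
  · exact absurd hocc (not_isOccurrenceObstructionAt_ps_of_bip2019_cor_2_6 h26 hfin hn hnm χ)
  · exact hrest

end PowerSumModel

end Literature.Computability.AlgebraicComplexity
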